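import Literature.Probability.LatticeModels.LeeYangLatticeLawRoots
import HarnessLib

/-!
# Lee–Yang lattice laws, II: Newman's product formula `F(z) = cosh^m z ∏ᵢ (1 + bᵢ sinh² z)`

For a Lee–Yang lattice law `p` of size `K` (module docstring of `LeeYangLatticeLawRoots.lean`:
`p ≥ 0` symmetric on `ℤ`, supported on the parity class of `K` in `[-K, K]`, mass `1`, Laplace
transform `F(z) = ∑ p_k e^{zk}` vanishing only on `Re z = 0`):

* `exists_laplace_eq_cosh_pow_mul_prod` — there are `m, n ∈ ℕ` with `m + 2n ≤ K` and
  `b₁, …, bₙ ≥ 1` such that `F(z) = cosh^m z ∏ᵢ (1 + bᵢ sinh² z)` for ALL complex `z`. Proof: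
  `F(z) = e^{-zK'} Q(e^{2z})` for the generating polynomial `Q` of the frame (`NewmanLeeYang.genPoly`,
  degree `K' ≤ K`, `Q(1) = 1`); its roots lie on the unit circle (`NewmanLeeYang.norm_eq_one_of_isRoot`:
  Lee–Yang for `Re z > 0`, the flip for `Re z < 0`), are `≠ 1`, and are closed under conjugation;
  the root `-1` (multiplicity `m`) contributes `e^{2z} + 1 = 2e^z cosh z`, a conjugate pair `e^{±iα}`
  contributes `(e^{2z} - e^{iα})(e^{2z} - e^{-iα}) = 2e^{2z}(1 - cos α)(1 + b sinh² z)`,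
  `b = 2/(1 - cos α) = 1/sin²(α/2) ≥ 1`; the exponentials cancel since `m + 2n = K'`, and the
  constant is `F(0) = 1`. This is the finite form of Newman's `E(e^{zX}) = e^{bz²} ∏ⱼ (1 + z²/αⱼ²)`.
* `sum_mul_exp_eq_of_laplace` (real axis): `∑ p_k e^{tk} = cosh^m t ∏ᵢ (1 + bᵢ sinh² t)`;
* `sum_mul_cos_eq_of_laplace` (imaginary axis): `∑ p_k cos(θk) = cos^m θ ∏ᵢ (1 - bᵢ sin² θ)` — so the
  zeros of the characteristic function are `cos θ = 0` (if `m ≥ 1`) and `sin² θ = 1/bᵢ`;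
* `sum_mul_mul_exp_eq_of_sum_mul_exp_eq` (tilted mean, logarithmic derivative):
  `∑ p_k k e^{tk} = cosh^m t ∏ᵢ (1 + bᵢ sinh² t) · (m tanh t + ∑ᵢ 2bᵢ sinh t cosh t/(1 + bᵢ sinh² t))`.

Related: `LeeYangTrigProduct.lean` (`LeeYangTrig.exists_trig_prod`) proves the imaginary-axis product
`M(iξ) = cos^a(ξω) ∏_θ (1 - sin²(ξω)/sin²(θ/2))` in the frame `expPoly c deg n ω` of a law indexed by
configurations; the present files work with a law `p` on `ℤ` and prove the identity for COMPLEX `z`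
(needed for the `cosh` form, the tilted mean and the moment identities, which must share one set of
parameters `m, bᵢ`). The second moment, Newman's inequality for the fourth cumulant and the
first-zero bound follow in a sequel. No definitions and no named facts are introduced.

## References

* C. M. Newman, *Inequalities for Ising models and field theories which obey the Lee–Yang
  theorem*, Comm. Math. Phys. 41 (1975) 1–9: Proposition 2 (product representation). [Newman1975]
-/

noncomputable section

namespace Literature.Probability.LatticeModels

open Literature.Barriers.CriticalPhenomena Finset Polynomial

namespace LeeYangLatticeLaw

/-! ### The factorisation of the Laplace transform -/

/-- **Newman's product representation on the lattice.** Let `p ≥ 0` be symmetric on `ℤ`,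
vanishing off the parity class of `K` and of total mass `1` on `[-K, K]`, and suppose its Laplace
transform `F(z) = ∑_{|k| ≤ K} p_k e^{zk}` vanishes only on the imaginary axis (Lee–Yang property).
Then there are `m, n ∈ ℕ` with `m + 2n ≤ K` and `b₁, …, bₙ ≥ 1` such that, for EVERY complex `z`,
`F(z) = cosh^m z · ∏ᵢ (1 + bᵢ sinh² z)`.
(`F(z) = e^{-zK'}Q(e^{2z})` for the generating polynomial `Q` of degree `K' ≤ K`, `Q(0) ≠ 0`,
`Q(1) = 1`, all roots on the unit circle and closed under conjugation; `m` is the multiplicity of the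
root `-1`, the `n` conjugate pairs `e^{±iα}` give `bᵢ = 2/(1 - cos αᵢ) = 1/sin²(αᵢ/2)`, and
`e^{2z} + 1 = 2e^z cosh z`, `(e^{2z} - e^{iα})(e^{2z} - e^{-iα}) = 4e^{2z} sin²(α/2)(1 + b sinh² z)`;
the constant is fixed by `F(0) = 1`.) This is the finite (lattice) form of Newman's Hadamard product
`E(e^{zX}) = e^{bz²} ∏ (1 + z²/αⱼ²)`.
[cite: Newman1975, Proposition 2 (product representation), lattice form] -/
theorem exists_laplace_eq_cosh_pow_mul_prod (K : ℕ) (p : ℤ → ℝ) (h0 : ∀ k, 0 ≤ p k)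
    (hsymm : ∀ k, p (-k) = p k) (hpar : ∀ k : ℤ, ¬ (2 ∣ (k + K)) → p k = 0)
    (hsum : ∑ k ∈ Icc (-(K : ℤ)) K, p k = 1)
    (hLY : ∀ z : ℂ, (∑ k ∈ Icc (-(K : ℤ)) K, (p k : ℂ) * Complex.exp (z * (k : ℂ))) = 0 → z.re = 0) :
    ∃ (m n : ℕ) (b : Fin n → ℝ), (∀ i, 1 ≤ b i) ∧ (m + 2 * n ≤ K) ∧
      ∀ z : ℂ, ∑ k ∈ Icc (-(K : ℤ)) K, (p k : ℂ) * Complex.exp (z * (k : ℂ)) =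
        Complex.cosh z ^ m * ∏ i, (1 + (b i : ℂ) * Complex.sinh z ^ 2) := by
  classical
  obtain ⟨S, K', m, ψ, τ₁, hK'K, hp, hmK, hψp, hψm, h1, hspin, htr⟩ :=
    exists_frame K p h0 hsymm hpar hsum
  set q : ↥S → ℝ := fun τ => p τ with hq
  have hq1 : ∑ τ, q τ = 1 := by rw [hq, ← hsum]; exact htr p fun k hk => hk
  have h0' : m (ψ τ₁) = 0 := by have := hψm τ₁; omega
  -- the Laplace transform on `S` is the Laplace transform on `[-K, K]`
  have hF : ∀ z : ℂ, ∑ τ, (q τ : ℂ) * Complex.exp (z * (NewmanLeeYang.spinSum m K' τ : ℂ)) =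
      ∑ k ∈ Icc (-(K : ℤ)) K, (p k : ℂ) * Complex.exp (z * (k : ℂ)) := by
    intro z
    rw [← htr (fun k => (p k : ℂ) * Complex.exp (z * (k : ℂ))) (fun k hk => by simp [hk])]
    refine Fintype.sum_congr _ _ fun τ => ?_
    rw [hspin τ]
    push_cast
    rfl
  have hLY' : ∀ z : ℂ, 0 < z.re →
      ∑ τ, (q τ : ℂ) * Complex.exp (z * (NewmanLeeYang.spinSum m K' τ : ℂ)) ≠ 0 := by
    intro z hz h
    rw [hF] at h
    exact hz.ne' (hLY z h)
  have hroots : ∀ u : ℂ, (NewmanLeeYang.genPoly q m).IsRoot u → ‖u‖ = 1 := fun u hu =>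
    NewmanLeeYang.norm_eq_one_of_isRoot hp ψ hψp hψm h0' hLY' hu
  set P := NewmanLeeYang.genPoly q m with hP
  set R := P.roots with hR
  have hP1 : P.eval 1 = 1 := NewmanLeeYang.genPoly_eval_one q m hq1
  have hP0 : P ≠ 0 := fun h => by rw [h, eval_zero] at hP1; exact zero_ne_one hP1
  have hRmem : ∀ r ∈ R, ‖r‖ = 1 ∧ r ≠ 1 := by
    intro r hr
    have hroot := (mem_roots hP0).1 hr
    refine ⟨hroots r hroot, ?_⟩
    rintro rfl
    rw [hroot.eq_zero] at hP1
    exact zero_ne_one hP1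
  have hconj : R.map (starRingEnd ℂ) = R := roots_genPoly_map_conj q m
  have hcard : Multiset.card R = K' := by
    rw [hR, ← (IsAlgClosed.splits P).natDegree_eq_card_roots, hP,
      NewmanLeeYang.natDegree_genPoly q m K' hp hmK h1]
  obtain ⟨hA, hcardA⟩ := prod_map_sub_eq_pow_mul_prod hRmem hconj
  set R₀ := R.filter fun r => r.im = 0 with hR₀
  set Rp := R.filter fun r => 0 < r.im with hRp
  obtain ⟨n, ρ, hn, hρmem, hρC, -, -⟩ := exists_fin_enum Rp
  have hρre : ∀ i, (ρ i).re < 1 ∧ -1 ≤ (ρ i).re := fun i =>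
    NewmanLeeYang.re_lt_one_of_mem_roots hq1 hroots (Multiset.mem_filter.1 (hρmem i)).1
  refine ⟨Multiset.card R₀, n, fun i => 2 / (1 - (ρ i).re), fun i => ?_, by omega, ?_⟩
  · obtain ⟨h1, h2⟩ := hρre i
    rw [le_div_iff₀ (by linarith)]
    linarith
  -- the pair factors at `u = e^{2z}`
  have hpair : ∀ (z : ℂ), ∀ r ∈ Rp, (Complex.exp (2 * z) - r) * (Complex.exp (2 * z) - (starRingEnd ℂ) r) =
      Complex.exp (2 * z) * (((2 * (1 - r.re) : ℝ) : ℂ) *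
        (1 + ((2 / (1 - r.re) : ℝ) : ℂ) * Complex.sinh z ^ 2)) := by
    intro z r hr
    have hrR : r ∈ R := (Multiset.mem_filter.1 hr).1
    have hre := (NewmanLeeYang.re_lt_one_of_mem_roots hq1 hroots hrR).1
    have hn1 : ‖r‖ = 1 := (hRmem r hrR).1
    have ha : r + (starRingEnd ℂ) r = 2 * (r.re : ℂ) := by rw [Complex.add_conj]; push_cast; ring
    have hm : r * (starRingEnd ℂ) r = 1 := by
      rw [Complex.mul_conj, Complex.normSq_eq_norm_sq, hn1]; simp
    have e1 : (Complex.exp (2 * z) - r) * (Complex.exp (2 * z) - (starRingEnd ℂ) r) =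
        Complex.exp (2 * z) ^ 2 - 2 * (r.re : ℂ) * Complex.exp (2 * z) + 1 := by
      linear_combination (-Complex.exp (2 * z)) * ha + hm
    rw [e1, exp_two_mul_sq_sub z r.re]
    have hne : (1 : ℂ) - (r.re : ℂ) ≠ 0 := by
      have h : ((1 - r.re : ℝ) : ℂ) ≠ 0 := Complex.ofReal_ne_zero.2 (by linarith)
      push_cast at h
      exact h
    congr 1
    push_cast
    field_simp
    ring
  -- the exponential prefactors cancel: `K' = m + 2n`
  have hexp : ∀ z : ℂ, Complex.exp (-(z * K')) * Complex.exp z ^ Multiset.card R₀ *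
      Complex.exp (2 * z) ^ Multiset.card Rp = 1 := by
    intro z
    have hK' : (K' : ℂ) = (Multiset.card R₀ : ℕ) + 2 * (Multiset.card Rp : ℕ) := by
      rw [← hcard, hcardA]; push_cast; ring
    rw [← Complex.exp_nat_mul, ← Complex.exp_nat_mul, ← Complex.exp_add, ← Complex.exp_add, hK']
    convert Complex.exp_zero using 2
    ring
  -- `F(z) = D · G(z)` with a constant `D`
  set D : ℂ := P.leadingCoeff * 2 ^ Multiset.card R₀ *
    (Rp.map fun r => ((2 * (1 - r.re) : ℝ) : ℂ)).prod with hD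
  have hG : ∀ z : ℂ, ∑ k ∈ Icc (-(K : ℤ)) K, (p k : ℂ) * Complex.exp (z * (k : ℂ)) =
      D * (Complex.cosh z ^ Multiset.card R₀ *
        ∏ i, (1 + ((2 / (1 - (ρ i).re) : ℝ) : ℂ) * Complex.sinh z ^ 2)) := by
    intro z
    rw [← hF z, NewmanLeeYang.sum_exp_eq_genPoly_eval, (IsAlgClosed.splits P).eval_eq_prod_roots, hA,
      exp_two_mul_add_one z, Multiset.map_congr rfl (hpair z), Multiset.prod_map_mul,
      Multiset.prod_map_mul, Multiset.map_const', Multiset.prod_replicate,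
      hρC (fun r => 1 + ((2 / (1 - r.re) : ℝ) : ℂ) * Complex.sinh z ^ 2), hD]
    linear_combination (P.leadingCoeff * 2 ^ Multiset.card R₀ *
      (Rp.map fun r => ((2 * (1 - r.re) : ℝ) : ℂ)).prod * Complex.cosh z ^ Multiset.card R₀ *
      ∏ i, (1 + ((2 / (1 - (ρ i).re) : ℝ) : ℂ) * Complex.sinh z ^ 2)) * hexp z
  have hD1 : D = 1 := by
    have h := hG 0
    simp only [zero_mul, Complex.exp_zero, mul_one, Complex.cosh_zero, Complex.sinh_zero, one_pow,
      ne_eq, OfNat.ofNat_ne_zero, not_false_eq_true, zero_pow, mul_zero, add_zero,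
      Finset.prod_const_one] at h
    rw [← Complex.ofReal_sum, hsum, Complex.ofReal_one] at h
    exact h.symm
  intro z
  rw [hG z, hD1, one_mul]

/-! ### On the real and on the imaginary axis -/

/-- **Real axis**: `∑ p_k e^{tk} = cosh^m t ∏ᵢ (1 + bᵢ sinh² t)` for real `t`.
[cite: Newman1975, Proposition 2 (product representation), lattice form] -/
theorem sum_mul_exp_eq_of_laplace {K : ℕ} {p : ℤ → ℝ} {m n : ℕ} {b : Fin n → ℝ}
    (h : ∀ z : ℂ, ∑ k ∈ Icc (-(K : ℤ)) K, (p k : ℂ) * Complex.exp (z * (k : ℂ)) =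
      Complex.cosh z ^ m * ∏ i, (1 + (b i : ℂ) * Complex.sinh z ^ 2)) (t : ℝ) :
    ∑ k ∈ Icc (-(K : ℤ)) K, p k * Real.exp (t * k) =
      Real.cosh t ^ m * ∏ i, (1 + b i * Real.sinh t ^ 2) := by
  apply Complex.ofReal_injective
  have h1 := h t
  push_cast
  exact h1

/-- **Imaginary axis**: `∑ p_k cos(θk) = cos^m θ ∏ᵢ (1 - bᵢ sin² θ)` for real `θ` (real part of
the identity at `z = iθ`: `cosh iθ = cos θ`, `sinh iθ = i sin θ`).
[cite: Newman1975, Proposition 2 (product representation), lattice form] -/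
theorem sum_mul_cos_eq_of_laplace {K : ℕ} {p : ℤ → ℝ} {m n : ℕ} {b : Fin n → ℝ}
    (h : ∀ z : ℂ, ∑ k ∈ Icc (-(K : ℤ)) K, (p k : ℂ) * Complex.exp (z * (k : ℂ)) =
      Complex.cosh z ^ m * ∏ i, (1 + (b i : ℂ) * Complex.sinh z ^ 2)) (θ : ℝ) :
    ∑ k ∈ Icc (-(K : ℤ)) K, p k * Real.cos (θ * k) =
      Real.cos θ ^ m * ∏ i, (1 - b i * Real.sin θ ^ 2) := by
  have h1 := h (θ * Complex.I)
  have hR : Complex.cosh (θ * Complex.I) ^ m *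
      ∏ i, (1 + (b i : ℂ) * Complex.sinh (θ * Complex.I) ^ 2) =
        ((Real.cos θ ^ m * ∏ i, (1 - b i * Real.sin θ ^ 2) : ℝ) : ℂ) := by
    rw [Complex.cosh_mul_I, Complex.sinh_mul_I]
    push_cast
    congr 1
    refine Finset.prod_congr rfl fun i _ => ?_
    rw [mul_pow, Complex.I_sq]
    ring
  have hL : (∑ k ∈ Icc (-(K : ℤ)) K, (p k : ℂ) * Complex.exp (θ * Complex.I * (k : ℂ))).re =
      ∑ k ∈ Icc (-(K : ℤ)) K, p k * Real.cos (θ * k) := by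
    rw [Complex.re_sum]
    refine Finset.sum_congr rfl fun k _ => ?_
    rw [Complex.re_ofReal_mul, show (θ : ℂ) * Complex.I * (k : ℂ) = ((θ * k : ℝ) : ℂ) * Complex.I by
      push_cast; ring, Complex.exp_ofReal_mul_I_re]
  rw [← hL, h1, hR, Complex.ofReal_re]

/-! ### The tilted mean: differentiating the real-axis identity -/

/-- **Tilted mean.** From `M(t) = ∑ p_k e^{tk} = cosh^m t ∏ᵢ (1 + bᵢ sinh² t)` (`bᵢ ≥ 0`):
`∑ p_k k e^{tk} = M(t) · (m tanh t + ∑ᵢ 2bᵢ sinh t cosh t / (1 + bᵢ sinh² t))` — the logarithmic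
derivative of the product (`M = exp(m log cosh + ∑ log(1 + bᵢ sinh²))`, uniqueness of derivatives).
[folklore] -/
theorem sum_mul_mul_exp_eq_of_sum_mul_exp_eq {K : ℕ} {p : ℤ → ℝ} {m n : ℕ} {b : Fin n → ℝ}
    (hb : ∀ i, 0 ≤ b i)
    (h : ∀ t : ℝ, ∑ k ∈ Icc (-(K : ℤ)) K, p k * Real.exp (t * k) =
      Real.cosh t ^ m * ∏ i, (1 + b i * Real.sinh t ^ 2)) (t : ℝ) :
    ∑ k ∈ Icc (-(K : ℤ)) K, p k * (k * Real.exp (t * k)) =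
      (Real.cosh t ^ m * ∏ i, (1 + b i * Real.sinh t ^ 2)) *
        (m * Real.tanh t + ∑ i, 2 * b i * Real.sinh t * Real.cosh t / (1 + b i * Real.sinh t ^ 2)) := by
  -- derivative of the left-hand side
  have hM : HasDerivAt (fun s => ∑ k ∈ Icc (-(K : ℤ)) K, p k * Real.exp (s * k))
      (∑ k ∈ Icc (-(K : ℤ)) K, p k * (k * Real.exp (t * k))) t := by
    refine HasDerivAt.fun_sum fun k _ => ?_
    exact (((hasDerivAt_mul_const (k : ℝ)).exp).const_mul (p k)).congr_deriv (by ring)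
  -- the right-hand side as an exponential
  set L : ℝ → ℝ := fun s => (m : ℝ) * Real.log (Real.cosh s) + ∑ i, Real.log (1 + b i * Real.sinh s ^ 2)
    with hL
  have hpos : ∀ (s : ℝ) (i : Fin n), 0 < 1 + b i * Real.sinh s ^ 2 := fun s i => by
    have := hb i; positivity
  have hexpL : ∀ s, Real.exp (L s) = Real.cosh s ^ m * ∏ i, (1 + b i * Real.sinh s ^ 2) := by
    intro s
    rw [hL]
    simp only
    rw [Real.exp_add, Real.exp_nat_mul, Real.exp_log (Real.cosh_pos s), Real.exp_sum]
    congr 1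
    exact Finset.prod_congr rfl fun i _ => Real.exp_log (hpos s i)
  have hL' : HasDerivAt L
      (m * Real.tanh t + ∑ i, 2 * b i * Real.sinh t * Real.cosh t / (1 + b i * Real.sinh t ^ 2)) t := by
    refine HasDerivAt.add ?_ (HasDerivAt.fun_sum fun i _ => ?_)
    · have := ((Real.hasDerivAt_cosh t).log (Real.cosh_pos t).ne').const_mul (m : ℝ)
      rw [Real.tanh_eq_sinh_div_cosh]
      exact this
    · have h1 : HasDerivAt (fun s => 1 + b i * Real.sinh s ^ 2) (b i * (2 * Real.sinh t * Real.cosh t)) t :=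
        ((((Real.hasDerivAt_sinh t).fun_pow 2).const_mul (b i)).const_add 1).congr_deriv
          (by norm_num)
      exact (h1.log (hpos t i).ne').congr_deriv (by ring)
  have hfun : (fun s => ∑ k ∈ Icc (-(K : ℤ)) K, p k * Real.exp (s * k)) = fun s => Real.exp (L s) :=
    funext fun s => by rw [h s, hexpL s]
  have hM' : HasDerivAt (fun s => ∑ k ∈ Icc (-(K : ℤ)) K, p k * Real.exp (s * k))
      (Real.exp (L t) * (m * Real.tanh t +
        ∑ i, 2 * b i * Real.sinh t * Real.cosh t / (1 + b i * Real.sinh t ^ 2))) t := by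
    rw [hfun]
    exact hL'.exp
  rw [hM.unique hM', hexpL]

end LeeYangLatticeLaw

end Literature.Probability.LatticeModels
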